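import Mathlib

/-!
# Coordinate partial derivations of `κ⟦u₀,u₁,u₂⟧` — stub `stub_deriv` of line `refutation-cuspidal-edge` (crux stmt-ResolutionOfSingularities-18182, route ShadowGame)

We construct the coordinate partial derivations `D i = ∂/∂uᵢ` of `MvPowerSeries (Fin 3) κ`
(`κ` a field of characteristic `p`) as `κ`-linear maps, DEFINED by the coefficient formula
`coeff d (D i f) = (d i + 1) · coeff (d + eᵢ) f`, and prove: the Leibniz rule (by truncating to
`MvPolynomial` with `MvPowerSeries.trunc'` and using `MvPolynomial.pderiv`, the same way Mathlib
treats `PowerSeries.derivative`), the power rule, `D i (g ^ p) = 0` in characteristic `p`, and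
`D i (X j) = δᵢⱼ`.  All helper lemmas are stated for an arbitrary linear map `D` satisfying the
coefficient formula, over any commutative semiring.
-/

noncomputable section

set_option linter.dupNamespace false

namespace Summit.ResolutionOfSingularities.ResolutionOfSingularities.Theorems.ShadowGameWinR.Negative

open MvPowerSeries

variable {σ : Type*} {R : Type*} [CommSemiring R]

/-- Existence of the `i`-th coordinate partial derivation as a linear map with the prescribed
coefficients `coeff d (D f) = (d i + 1) · coeff (d + eᵢ) f`. [folklore] -/
theorem exists_linearMap_coeff_deriv (i : σ) :
    ∃ D : MvPowerSeries σ R →ₗ[R] MvPowerSeries σ R, ∀ (f : MvPowerSeries σ R) (d : σ →₀ ℕ),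
      coeff d (D f) = ((d i + 1 : ℕ) : R) * coeff (d + Finsupp.single i 1) f :=
  ⟨{ toFun := fun f d => ((d i + 1 : ℕ) : R) * coeff (d + Finsupp.single i 1) f
     map_add' := fun f g => by
       funext d
       show _ * coeff _ (f + g) = _ * coeff _ f + _ * coeff _ g
       rw [map_add, mul_add]
     map_smul' := fun c f => by
       funext d
       show _ * coeff _ (c • f) = c * (_ * coeff _ f)
       rw [map_smul, smul_eq_mul, mul_left_comm] }, fun _ _ => rfl⟩

variable [DecidableEq σ]

/-- Truncation intertwines a coefficientwise partial derivation `D` (in the variable `i`) of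
multivariate power series with `MvPolynomial.pderiv i`. [folklore] -/
theorem pderiv_trunc'_of_coeff_deriv {i : σ} {D : MvPowerSeries σ R →ₗ[R] MvPowerSeries σ R}
    (hD : ∀ (f : MvPowerSeries σ R) (d : σ →₀ ℕ),
      coeff d (D f) = ((d i + 1 : ℕ) : R) * coeff (d + Finsupp.single i 1) f)
    (f : MvPowerSeries σ R) (d : σ →₀ ℕ) :
    MvPolynomial.pderiv i (trunc' R (d + Finsupp.single i 1) f) = trunc' R d (D f) := by
  ext m
  rw [MvPolynomial.coeff_pderiv, coeff_trunc', coeff_trunc', hD]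
  by_cases hm : m ≤ d
  · rw [if_pos (add_le_add hm le_rfl), if_pos hm, mul_comm, Nat.cast_succ]
  · rw [if_neg hm, if_neg, zero_mul]
    exact fun h => hm (Finsupp.le_def.2 fun j => by simpa using Finsupp.le_def.1 h j)

/-- Leibniz rule for a coefficientwise partial derivation of multivariate power series, via
truncation to polynomials. [folklore] -/
theorem leibniz_of_coeff_deriv {i : σ} {D : MvPowerSeries σ R →ₗ[R] MvPowerSeries σ R}
    (hD : ∀ (f : MvPowerSeries σ R) (d : σ →₀ ℕ),
      coeff d (D f) = ((d i + 1 : ℕ) : R) * coeff (d + Finsupp.single i 1) f)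
    (f g : MvPowerSeries σ R) : D (f * g) = f * D g + g * D f := by
  ext d
  rw [hD, map_add, ← coeff_trunc'_mul_trunc'_eq_coeff_mul (d + Finsupp.single i 1) f g le_rfl]
  have h := MvPolynomial.coeff_pderiv (i := i)
    (trunc' R (d + Finsupp.single i 1) f * trunc' R (d + Finsupp.single i 1) g) d
  rw [MvPolynomial.pderiv_mul, MvPolynomial.coeff_add, pderiv_trunc'_of_coeff_deriv hD,
    pderiv_trunc'_of_coeff_deriv hD,
    coeff_trunc'_mul_trunc'_eq_coeff_mul₂ d (d + Finsupp.single i 1) (D f) g le_rfl le_self_add,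
    coeff_trunc'_mul_trunc'_eq_coeff_mul₂ (d + Finsupp.single i 1) d f (D g) le_self_add le_rfl]
    at h
  rw [Nat.cast_succ, mul_comm, ← h, add_comm, mul_comm (D f) g]

/-- A coefficientwise partial derivation kills `1`. [folklore] -/
theorem deriv_one_of_coeff_deriv {i : σ} {D : MvPowerSeries σ R →ₗ[R] MvPowerSeries σ R}
    (hD : ∀ (f : MvPowerSeries σ R) (d : σ →₀ ℕ),
      coeff d (D f) = ((d i + 1 : ℕ) : R) * coeff (d + Finsupp.single i 1) f) :
    D 1 = 0 := by
  ext d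
  rw [hD, coeff_one, if_neg, mul_zero, map_zero]
  exact fun h => by simpa using DFunLike.congr_fun h i

/-- Power rule for a coefficientwise partial derivation. [folklore] -/
theorem deriv_pow_succ_of_coeff_deriv {i : σ} {D : MvPowerSeries σ R →ₗ[R] MvPowerSeries σ R}
    (hD : ∀ (f : MvPowerSeries σ R) (d : σ →₀ ℕ),
      coeff d (D f) = ((d i + 1 : ℕ) : R) * coeff (d + Finsupp.single i 1) f)
    (g : MvPowerSeries σ R) (n : ℕ) :
    D (g ^ (n + 1)) = ((n : R) + 1) • (g ^ n * D g) := by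
  induction n with
  | zero => simp
  | succ n ih =>
    rw [pow_succ, leibniz_of_coeff_deriv hD, ih, mul_smul_comm, ← mul_assoc, ← pow_succ',
      Nat.cast_succ, add_smul ((n : R) + 1) (1 : R), one_smul, add_comm]

/-- In characteristic `p`, a coefficientwise partial derivation kills `p`-th powers. [folklore] -/
theorem deriv_pow_char_of_coeff_deriv (p : ℕ) [Fact p.Prime] [CharP R p] {i : σ}
    {D : MvPowerSeries σ R →ₗ[R] MvPowerSeries σ R}
    (hD : ∀ (f : MvPowerSeries σ R) (d : σ →₀ ℕ),
      coeff d (D f) = ((d i + 1 : ℕ) : R) * coeff (d + Finsupp.single i 1) f)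
    (g : MvPowerSeries σ R) : D (g ^ p) = 0 := by
  obtain ⟨n, hn⟩ : ∃ n, p = n + 1 :=
    Nat.exists_eq_succ_of_ne_zero (Nat.Prime.ne_zero (Fact.out : p.Prime))
  rw [hn, deriv_pow_succ_of_coeff_deriv hD, ← Nat.cast_add_one, ← hn, CharP.cast_eq_zero R p,
    zero_smul]

/-- A coefficientwise partial derivation in the variable `i` sends `X j` to `δᵢⱼ`. [folklore] -/
theorem deriv_X_of_coeff_deriv {i : σ} {D : MvPowerSeries σ R →ₗ[R] MvPowerSeries σ R}
    (hD : ∀ (f : MvPowerSeries σ R) (d : σ →₀ ℕ),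
      coeff d (D f) = ((d i + 1 : ℕ) : R) * coeff (d + Finsupp.single i 1) f)
    (j : σ) : D (X j) = if i = j then 1 else 0 := by
  ext d
  rw [hD, coeff_X]
  by_cases hij : i = j
  · subst hij
    rw [if_pos rfl, coeff_one]
    by_cases hd : d = 0
    · subst hd
      simp
    · rw [if_neg hd, if_neg (fun h => hd (add_eq_right.1 h)), mul_zero]
  · rw [if_neg hij, map_zero, if_neg, mul_zero]
    intro h
    have h' := DFunLike.congr_fun h i
    simp [Ne.symm hij] at h'

/-- **Stub `stub_deriv`.**  On `κ⟦u₀,u₁,u₂⟧` (`κ` a field of characteristic `p`) there are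
`κ`-linear coordinate partial derivations `D i = ∂/∂uᵢ`, `i : Fin 3`, with
`coeff d (D i f) = (d i + 1) · coeff (d + eᵢ) f`, satisfying the Leibniz rule, killing `p`-th
powers, and with `D i (X j) = δᵢⱼ`. [folklore] -/
theorem stub_deriv (p : ℕ) [Fact p.Prime] (κ : Type) [Field κ] [CharP κ p] :
    ∃ D : Fin 3 → (MvPowerSeries (Fin 3) κ →ₗ[κ] MvPowerSeries (Fin 3) κ),
      (∀ i (f : MvPowerSeries (Fin 3) κ) (d : Fin 3 →₀ ℕ),
          coeff d (D i f) = ((d i + 1 : ℕ) : κ) * coeff (d + Finsupp.single i 1) f) ∧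
      (∀ i (f g : MvPowerSeries (Fin 3) κ), D i (f * g) = f * D i g + g * D i f) ∧
      (∀ i (g : MvPowerSeries (Fin 3) κ), D i (g ^ p) = 0) ∧
      (∀ i j, D i (X j : MvPowerSeries (Fin 3) κ) = if i = j then 1 else 0) := by
  choose D hD using fun i : Fin 3 => exists_linearMap_coeff_deriv (R := κ) i
  exact ⟨D, hD, fun i f g => leibniz_of_coeff_deriv (hD i) f g,
    fun i g => deriv_pow_char_of_coeff_deriv p (hD i) g,
    fun i j => deriv_X_of_coeff_deriv (hD i) j⟩

end Summit.ResolutionOfSingularities.ResolutionOfSingularities.Theorems.ShadowGameWinR.Negative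

end
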